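import Summits.QuantumFields.BalabanUV.Beta.FP.PerfectPolarizationWardLetters
import Summits.QuantumFields.BalabanUV.Beta.D1BFx.GhostStencil

/-!
# `BalabanUV.Beta.FP.GhostGaugeLaw` — road «FP» for binder row D1, sub-row H2-ASM-5a «layer b», sequel: THE GHOST-SECTOR GAUGE-COMMUTATOR LAW (a4g-total) PROVED
# FOR THE ROAD's EXPLICIT GHOST CUBIC FAMILY `D1BFx.GhostStencil.ghCur` — `divV ghCur y = 1 • ((−Δ) ∘ ΠU_y − ΠU_y ∘ (−Δ))`, hence the ghost Ward letter (W1g) of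
# `FP/PerfectPolarizationWard.wardTransversal_flip_PiBF` holds for `v := ghCur` with the generator `Xg y = −ΠU_y` (via `PerfectPolarizationWardLetters.w1_ghost` ✓)

HONEST DEPENDENCY (page 1, mandatory): continuum YM on T⁴ ⇐ BetaPertH ∧ nine spine estimates (0/9 proved); BetaPertH ⇐ (D1) ∧ (D4) ∧ CAP+tail;
G-an2-4 gates asym, D1 and NE2/3/4.  HONEST FRAMING (cell contract, verbatim): «discharging `BetaPertH` makes Bałaban's UV stability UNCONDITIONAL —
a real constructive-QFT result; it is NOT the continuum limit and NOT the Clay problem.»  THIS MODULE DISCHARGES NOTHING of the wall: explicit finite stencil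
algebra on `ℤ⁴` ([our object] identities about the typer's `ghCur` and this lineage's `lapKer`∕`projU`); 0 def, no `def … : Prop`, nothing cited, 0 sorry; 0∕4 row-D1 binders;
NOT (a8g) (the quartic ghost table's second-order law — `GhostStencil.Wgh` types the same-bond contact only; its `divW` is diagonal-supported and is NOT
`[Xg, ghCur]`; stays a letter), NOT the gluon (a4-total) (H2V-4), NOT (K0), NOT D1, NOT BetaPertH, NOT continuum, NOT Clay.  «not in print; our bookkeeping».

ABSOLUTE RULE (cell charter, verbatim): «No internally-minted statement may enter as a cited fact. Every hypothesis is either kernel-proved in this package or a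
verbatim quotation of a PUBLISHED theorem with page reference. The manuscript(s) under audit are NOT citable for their own disputed steps — they are the thing
under adjudication; programme-internal (2001/route/tribunal) claims are never citable.»

CONTENT.
* [folklore] `unitVec_eq` (the two `unitVec`s of the tree agree: `B6BondElimination.unitVec μ = AffineAveraging.unitVec μ`), `ite_and_one` (a conjunction indicator is the
  product of the indicators).
* [our object] `ghCur_apply_mul` (the current in product form), `divV_ghCur_apply` (the divergence entrywise, product form), `commutator_apply` ∕ `commutator_apply'`
  (`((−Δ) ∘ ΠU_y − ΠU_y ∘ (−Δ)) x z = [z = y]·lapKer x y − [x = y]·lapKer y z`), `lapKer_apply'` (the `unitVec` spelling, `rfl`),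
  **`divV_ghCur : divV ghCur y = (1 : ℝ) • (comp lapKer (projU y) − comp (projU y) lapKer)`** (no case analysis: both sides are
  `[x = y]·Σ_μ([z = y + e_μ] + [z = y − e_μ]) − [z = y]·Σ_μ([x = y + e_μ] + [x = y − e_μ])` by `ring` over the indicator atoms and `lapKer_symm`), **`w1_ghCur`**.
Provenance: G-an2-4 formalisation swarm seat b2b-balaban-gan24-formalise-leaf-02 gen 40 (prover-b2b-balaban-gan24-formalise-leaf-02-g40-0; cross-lane on road FP), 2026-08-21.
-/

noncomputable section

namespace Summit.QuantumFields.BalabanUV.Beta.FP.GhostGaugeLaw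

open Finset
open scoped BigOperators
open Literature.MathematicalPhysics.QuantumFieldTheory.Balaban1983to89
open Literature.MathematicalPhysics.QuantumFieldTheory.Balaban1983to89.Beta
open ExpKernelCalculus (MKer Site comp)
open KernelWard (divV)
open Summit.QuantumFields.BalabanUV.Beta.D1BFx.GhostStencil (ghCur ghCur_apply unitVec_ne_zero)
open Summit.QuantumFields.BalabanUV.Beta.FP.PerfectPolarization (G0ker)
open Summit.QuantumFields.BalabanUV.Beta.FP.WardSandwichEngine (projM projM_apply comp_projM projM_comp)
open Summit.QuantumFields.BalabanUV.Beta.FP.PerfectPolarizationWardLetters (lapKer lapKer_apply projU projU_def w1_ghost)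

/-- [folklore] the two unit vectors of the tree agree: `B6BondElimination.unitVec μ = AffineAveraging.unitVec μ` (`= Pi.single μ 1`). -/
theorem unitVec_eq (μ : Fin 4) : (B6BondElimination.unitVec μ : Site 4) = AffineAveraging.unitVec μ := by
  funext i
  simp [B6BondElimination.unitVec, AffineAveraging.unitVec, Pi.single_apply]

/-- [folklore] a conjunction indicator is the product of the indicators. -/
theorem ite_and_one (P Q : Prop) [Decidable P] [Decidable Q] :
    (if P ∧ Q then (1 : ℝ) else 0) = (if P then (1 : ℝ) else 0) * (if Q then (1 : ℝ) else 0) := by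
  rw [ite_zero_mul_ite_zero, one_mul]

/-- [our object] the ghost current in product form: `ghCur κ u x z = [x = u + e_κ]·[z = u] − [x = u]·[z = u + e_κ]`. -/
theorem ghCur_apply_mul (κ : Fin 4) (u x z : Site 4) (a b : Unit) : ghCur κ u x z a b
    = (if x = u + AffineAveraging.unitVec κ then (1 : ℝ) else 0) * (if z = u then (1 : ℝ) else 0)
      - (if x = u then (1 : ℝ) else 0) * (if z = u + AffineAveraging.unitVec κ then (1 : ℝ) else 0) := by
  rw [ghCur_apply, ite_and_one, ite_and_one]

/-- [our object] THE DIVERGENCE OF THE GHOST CURRENT, entrywise, in product form: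
`(divV ghCur y) x z = Σ_μ ([x = y]·[z = y − e_μ] − [x = y − e_μ]·[z = y] − ([x = y + e_μ]·[z = y] − [x = y]·[z = y + e_μ]))`. -/
theorem divV_ghCur_apply (y x z : Site 4) (a b : Unit) : divV ghCur y x z a b
    = ∑ μ : Fin 4, ((if x = y then (1 : ℝ) else 0) * (if z = y - AffineAveraging.unitVec μ then (1 : ℝ) else 0)
        - (if x = y - AffineAveraging.unitVec μ then (1 : ℝ) else 0) * (if z = y then (1 : ℝ) else 0)
        - ((if x = y + AffineAveraging.unitVec μ then (1 : ℝ) else 0) * (if z = y then (1 : ℝ) else 0)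
          - (if x = y then (1 : ℝ) else 0) * (if z = y + AffineAveraging.unitVec μ then (1 : ℝ) else 0))) := by
  unfold divV
  simp only [Finset.sum_apply, Pi.sub_apply, ghCur_apply_mul, unitVec_eq, sub_add_cancel]

/-- [our object] THE COMMUTATOR OF `−Δ` WITH THE SCALAR SITE PROJECTION, entrywise:
`((−Δ) ∘ ΠU_y − ΠU_y ∘ (−Δ)) x z = [z = y]·lapKer x y − [x = y]·lapKer y z`. -/
theorem commutator_apply (y x z : Site 4) (a b : Unit) : (comp lapKer (projU y) - comp (projU y) lapKer) x z a b
    = (if z = y then lapKer x y a b else 0) - (if x = y then lapKer y z a b else 0) := by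
  rw [Pi.sub_apply, Pi.sub_apply, Pi.sub_apply, Pi.sub_apply, projU_def, comp_projM, projM_comp, mul_one, one_mul]

/-- [our object] the same in product form: `[z = y]·lapKer x y − [x = y]·lapKer y z`. -/
theorem commutator_apply' (y x z : Site 4) (a b : Unit) : (comp lapKer (projU y) - comp (projU y) lapKer) x z a b
    = (if z = y then (1 : ℝ) else 0) * lapKer x y a b - (if x = y then (1 : ℝ) else 0) * lapKer y z a b := by
  rw [commutator_apply, boole_mul, boole_mul]

/-- [our object] `lapKer`'s entries in the `unitVec` spelling (definitionally `lapKer_apply`). -/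
theorem lapKer_apply' (y z : Site 4) (a b : Unit) : lapKer y z a b =
    8 * (if z = y then 1 else 0) - ∑ i : Fin 4, ((if z = y + AffineAveraging.unitVec i then (1 : ℝ) else 0)
      + (if z = y - AffineAveraging.unitVec i then 1 else 0)) := rfl

/-- [our object] **THE GHOST GAUGE-COMMUTATOR LAW (a4g-total) FOR THE EXPLICIT GHOST CURRENT**: `divV ghCur y = 1 • ((−Δ) ∘ ΠU_y − ΠU_y ∘ (−Δ))` —
the lattice divergence (in the background bond) of the antisymmetric ghost-kinetic first jet IS the commutator of minus the scalar Laplacian with the site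
projection at `y` (infinitesimal gauge covariance of `Δ_B` at `B = 𝟙`, colour-stripped), with constant `cg = 1`. -/
theorem divV_ghCur (y : Site 4) : divV ghCur y = (1 : ℝ) • (comp lapKer (projU y) - comp (projU y) lapKer) := by
  rw [one_smul]
  funext x z a b
  rw [divV_ghCur_apply, commutator_apply', PerfectPolarizationWardLetters.lapKer_symm x y a b, lapKer_apply', lapKer_apply']
  have e : ∀ μ : Fin 4,
      (if x = y then (1 : ℝ) else 0) * (if z = y - AffineAveraging.unitVec μ then (1 : ℝ) else 0)
        - (if x = y - AffineAveraging.unitVec μ then (1 : ℝ) else 0) * (if z = y then (1 : ℝ) else 0)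
        - ((if x = y + AffineAveraging.unitVec μ then (1 : ℝ) else 0) * (if z = y then (1 : ℝ) else 0)
          - (if x = y then (1 : ℝ) else 0) * (if z = y + AffineAveraging.unitVec μ then (1 : ℝ) else 0))
      = (if x = y then (1 : ℝ) else 0) * ((if z = y + AffineAveraging.unitVec μ then (1 : ℝ) else 0) + (if z = y - AffineAveraging.unitVec μ then 1 else 0))
        - (if z = y then (1 : ℝ) else 0) * ((if x = y + AffineAveraging.unitVec μ then (1 : ℝ) else 0) + (if x = y - AffineAveraging.unitVec μ then 1 else 0)) :=
    fun μ => by ring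
  rw [Finset.sum_congr rfl fun μ _ => e μ, Finset.sum_sub_distrib, ← Finset.mul_sum, ← Finset.mul_sum]
  ring

/-- [our object] **(W1g) FOR THE EXPLICIT GHOST CURRENT**: `(G0ker ∘ divV ghCur y) ∘ G0ker = G0ker ∘ (−ΠU_y) − (−ΠU_y) ∘ G0ker` — W2's ghost Ward letter with the
generator `Xg y = −ΠU_y`, from `divV_ghCur` and (G-INV) (`PerfectPolarizationWardLetters.w1_ghost` ✓). -/
theorem w1_ghCur (y : Site 4) :
    comp (comp G0ker (divV ghCur y)) G0ker = comp G0ker ((-(1 : ℝ)) • projU y) - comp ((-(1 : ℝ)) • projU y) G0ker := by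
  rw [divV_ghCur y, projU_def]
  exact w1_ghost 1 y

end Summit.QuantumFields.BalabanUV.Beta.FP.GhostGaugeLaw

end
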